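import Literature.MathematicalPhysics.StatisticalMechanics.Crystallization
import HarnessLib

/-!
# Symmetries: isometries and relabellings of configurations; images of periodic configurations

Topic: `Literature/MathematicalPhysics/StatisticalMechanics`. API for `Crystallization.lean`
(Blanc–Lewin 2015): "𝓔_N is invariant under translations and rotations. Any configuration may
be rotated and translated by a fixed vector without changing the total energy. Minimizers of
(2) are thus not unique" (§1.1, arXiv p. 3); "if the positions of the particles form a periodic
lattice, then applying a translation, rotation or reflexion to the system does not change its
energy. Hence, the set of minimizing lattices has the structure of the compact group
`(ℝᵈ/G) ⋊ O_d(ℝ)`" (§2.1, arXiv p. 6).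

## Content

Finite configurations `x : Fin N → ℝᵈ`:
* `interactionEnergy_comp_isometry` — `𝓔_N(φ ∘ x) = 𝓔_N(x)` for an isometry `φ` (translations:
  `interactionEnergy_add_const` in `LennardJonesClusters.lean`); `isGroundState_comp_isometry_iff`,
  `isGroundState_add_const_iff`.
* `two_mul_interactionEnergy_eq_sum_offDiag` — `2 𝓔_N = ∑_{i ≠ j} V(|xᵢ - xⱼ|)` (ordered pairs);
  `interactionEnergy_comp_equiv`, `isGroundState_comp_equiv_iff` — invariance under
  relabelling `x ∘ σ`, `σ ∈ 𝔖_N` (the energy is a function of the set of positions).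

Periodic configurations `F + G` (`PeriodicConfiguration`, Blanc–Lewin 2015, §2.1 (17)–(18)):
* `PeriodicConfiguration.translate P v` — motif `F + v`, same lattice; `mem_points_translate`
  (`z ∈ F + v + G ↔ z - v ∈ F + G`); `energyPerParticle_translate`.
* `PeriodicConfiguration.isometryImage P A` for a linear isometry `A : ℝᵈ ≃ₗᵢ[ℝ] ℝᵈ` — lattice
  `A G` (as the Mathlib pull-back `ZLattice.comap` of `G` by `A⁻¹`, which supplies the
  `DiscreteTopology` and `IsZLattice` instances), motif `A F`; `mem_lattice_isometryImage`,
  `mem_points_isometryImage` (`z ∈ A(F + G) ↔ A⁻¹ z ∈ F + G`); `energyPerParticle_isometryImage`.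
* `PeriodicConfiguration.linearImage P A` for an invertible continuous linear map `A : ℝᵈ ≃L[ℝ] ℝᵈ`
  (a homogeneous deformation; same construction) — `mem_lattice_linearImage`, `mem_points_linearImage`,
  `points_linearImage` (`= A '' (F + G)`), `card_motif_linearImage`, and the affine form
  `points_translate_linearImage` (`((P.linearImage A).translate t).points = (A · + t) '' (F + G)`):
  affine images of crystals are crystals (the anchor of Cauchy–Born energy comparisons; no energy identity,
  the energy per particle changes under deformation).

Use: in `IsCrystallizing` (Blanc–Lewin 2015, (16)) only translations `τ_j` act on the
particles, so a limit lattice in general position is presented as `isometryImage`/`translate`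
of a reference configuration; in `HasPeriodicGroundStateEnergy` a minimiser may be replaced by
any isometric image; ground states may be reordered (e.g. sorted) and moved freely.

## Sources

* X. Blanc, M. Lewin, *The crystallization conjecture: a review*, EMS Surv. Math. Sci. 2 (2015),
  255–306, arXiv:1504.01153, §1.1 (p. 3), §2.1 (p. 6), (23).
-/

noncomputable section

open scoped BigOperators Topology
open Filter Set Metric

namespace Literature.MathematicalPhysics.StatisticalMechanics

variable {d : ℕ}

/-! ## Finite configurations -/

section Finite

variable {N : ℕ} (V : ℝ → ℝ)

/-- The interaction energy (Blanc–Lewin 2015, (1)) is invariant under isometries of `ℝᵈ`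
applied to all particles — translations, rotations, reflexions ("𝓔_N is invariant under translations
and rotations. Any configuration may be rotated and translated by a fixed vector without
changing the total energy", Blanc–Lewin 2015, §1.1, arXiv p. 3).
[cite: BlancLewin2015, §1.1 (arXiv p. 3)] -/
theorem interactionEnergy_comp_isometry
    {φ : EuclideanSpace ℝ (Fin d) → EuclideanSpace ℝ (Fin d)} (hφ : Isometry φ)
    (x : Fin N → EuclideanSpace ℝ (Fin d)) :
    interactionEnergy V (φ ∘ x) = interactionEnergy V x := by
  simp only [interactionEnergy, Function.comp_apply, hφ.dist_eq]

/-- Isometries map ground states to ground states (and only ground states).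
[cite: BlancLewin2015, §1.1 (arXiv p. 3)] -/
theorem isGroundState_comp_isometry_iff
    {φ : EuclideanSpace ℝ (Fin d) → EuclideanSpace ℝ (Fin d)} (hφ : Isometry φ)
    {x : Fin N → EuclideanSpace ℝ (Fin d)} :
    IsGroundState V (φ ∘ x) ↔ IsGroundState V x := by
  simp only [IsGroundState, interactionEnergy_comp_isometry V hφ, hφ.injective.of_comp_iff]

/-- Translates of ground states are ground states (the translations `τ_j` of Blanc–Lewin 2015,
(16); the energy identity alone is `interactionEnergy_add_const` in `LennardJonesClusters.lean`).
[cite: BlancLewin2015, §1.1 (arXiv p. 3)] -/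
theorem isGroundState_add_const_iff (τ : EuclideanSpace ℝ (Fin d))
    {x : Fin N → EuclideanSpace ℝ (Fin d)} :
    IsGroundState V (fun i => x i + τ) ↔ IsGroundState V x :=
  isGroundState_comp_isometry_iff V (isometry_add_right τ)

/-- Twice the interaction energy is the sum over ordered pairs of distinct indices (cf.
`two_mul_interactionEnergy` in `LennardJonesClusters.lean`, the same identity through site
energies). [folklore] -/
theorem two_mul_interactionEnergy_eq_sum_offDiag (x : Fin N → EuclideanSpace ℝ (Fin d)) :
    2 * interactionEnergy V x =
      ∑ p ∈ (Finset.univ : Finset (Fin N)).offDiag, V (dist (x p.1) (x p.2)) := by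
  classical
  have hlt : ∑ p ∈ Finset.univ.offDiag with p.1 < p.2, V (dist (x p.1) (x p.2)) =
      interactionEnergy V x := by
    rw [interactionEnergy, ← Finset.sum_finset_product' _ Finset.univ (fun i => Finset.Ioi i) ?_]
    intro p
    simp only [Finset.mem_filter, Finset.mem_offDiag, Finset.mem_univ, true_and, Finset.mem_Ioi]
    exact ⟨fun h => h.2, fun h => ⟨ne_of_lt h, h⟩⟩
  have hgt : ∑ p ∈ Finset.univ.offDiag with ¬ p.1 < p.2, V (dist (x p.1) (x p.2)) =
      ∑ p ∈ Finset.univ.offDiag with p.1 < p.2, V (dist (x p.1) (x p.2)) := by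
    refine Finset.sum_equiv (Equiv.prodComm (Fin N) (Fin N)) (fun p => ?_) (fun p _ => ?_)
    · simp only [Finset.mem_filter, Finset.mem_offDiag, Finset.mem_univ, true_and,
        Equiv.prodComm_apply, Prod.fst_swap, Prod.snd_swap]
      constructor
      · rintro ⟨hne, hnlt⟩
        exact ⟨hne.symm, lt_of_le_of_ne (not_lt.1 hnlt) hne.symm⟩
      · rintro ⟨hne, hlt⟩
        exact ⟨hne.symm, not_lt.2 hlt.le⟩
    · simp [dist_comm]
  rw [← Finset.sum_filter_add_sum_filter_not _ (fun p : Fin N × Fin N => p.1 < p.2), hgt, hlt]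
  ring

/-- The interaction energy is invariant under relabelling of the particles (it is a function
of the set of positions). [folklore] -/
theorem interactionEnergy_comp_equiv (σ : Fin N ≃ Fin N) (x : Fin N → EuclideanSpace ℝ (Fin d)) :
    interactionEnergy V (x ∘ σ) = interactionEnergy V x := by
  classical
  have h := two_mul_interactionEnergy_eq_sum_offDiag V (x ∘ σ)
  have hre : ∑ p ∈ (Finset.univ : Finset (Fin N)).offDiag, V (dist ((x ∘ σ) p.1) ((x ∘ σ) p.2)) =
      ∑ p ∈ (Finset.univ : Finset (Fin N)).offDiag, V (dist (x p.1) (x p.2)) :=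
    Finset.sum_equiv (σ.prodCongr σ) (fun p => by simp [Finset.mem_offDiag, σ.injective.ne_iff])
      (fun p _ => rfl)
  rw [hre, ← two_mul_interactionEnergy_eq_sum_offDiag V x] at h
  linarith

/-- Relabelled ground states are ground states. [folklore] -/
theorem isGroundState_comp_equiv_iff (σ : Fin N ≃ Fin N) {x : Fin N → EuclideanSpace ℝ (Fin d)} :
    IsGroundState V (x ∘ σ) ↔ IsGroundState V x := by
  simp only [IsGroundState, interactionEnergy_comp_equiv V σ, σ.injective_comp]

end Finite

/-! ## Periodic configurations -/

namespace PeriodicConfiguration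

variable (P : PeriodicConfiguration d)

/-! ## Translates -/

/-- The translate `F + v + G` of a periodic configuration `F + G` by a vector `v`: same lattice
of periods, motif `F + v`. [folklore] -/
def translate (v : EuclideanSpace ℝ (Fin d)) : PeriodicConfiguration d where
  lattice := P.lattice
  discrete := P.discrete
  isZLattice := P.isZLattice
  motif := P.motif.map ⟨fun y => y + v, add_left_injective v⟩
  motif_nonempty := (Finset.map_nonempty).2 P.motif_nonempty
  eq_of_sub_mem := by
    intro x hx y hy hxy
    obtain ⟨x', hx', rfl⟩ := Finset.mem_map.1 hx
    obtain ⟨y', hy', rfl⟩ := Finset.mem_map.1 hy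
    have h : x' - y' ∈ P.lattice := by
      simpa [add_sub_add_right_eq_sub] using hxy
    simp [P.eq_of_sub_mem x' hx' y' hy' h]

/-- Points of the translate: `z ∈ F + v + G ↔ z - v ∈ F + G`. [folklore] -/
theorem mem_points_translate {v z : EuclideanSpace ℝ (Fin d)} :
    z ∈ (P.translate v).points ↔ z - v ∈ P.points := by
  constructor
  · rintro ⟨y, hy, g, hg, rfl⟩
    obtain ⟨y', hy', rfl⟩ := Finset.mem_map.1 hy
    exact ⟨y', hy', g, hg, by simp only [Function.Embedding.coeFn_mk]; abel⟩
  · rintro ⟨y', hy', g, hg, h⟩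
    refine ⟨y' + v, Finset.mem_map.2 ⟨y', hy', rfl⟩, g, hg, ?_⟩
    rw [sub_eq_iff_eq_add] at h
    rw [h]
    abel

/-- The lattice of periods of the translate is unchanged. [folklore] -/
@[simp] theorem lattice_translate (v : EuclideanSpace ℝ (Fin d)) :
    (P.translate v).lattice = P.lattice := rfl

/-- The motif of the translate has the same number of points. [folklore] -/
@[simp] theorem card_motif_translate (v : EuclideanSpace ℝ (Fin d)) :
    (P.translate v).motif.card = P.motif.card := Finset.card_map _

/-- The energy per particle (Blanc–Lewin 2015, (23)) is translation invariant ("applying a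
translation … does not change its energy", §2.1).
[cite: BlancLewin2015, §2.1 (arXiv p. 6)] -/
theorem energyPerParticle_translate (V : ℝ → ℝ) (v : EuclideanSpace ℝ (Fin d)) :
    (P.translate v).energyPerParticle V = P.energyPerParticle V := by
  unfold energyPerParticle
  rw [card_motif_translate]
  congr 1
  rw [show (P.translate v).motif = P.motif.map ⟨fun y => y + v, add_left_injective v⟩ from rfl,
    Finset.sum_map]
  refine Finset.sum_congr rfl fun x _ => ?_
  simp only [Function.Embedding.coeFn_mk]
  -- reindex the lattice sum by `y ↦ y + v`
  let e : {y // y ∈ P.points ∧ y ≠ x} ≃ {y // y ∈ (P.translate v).points ∧ y ≠ x + v} :=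
    (Equiv.addRight v).subtypeEquiv fun y => by
      simp only [Equiv.coe_addRight, ne_eq, add_left_inj, mem_points_translate, add_sub_cancel_right]
  rw [← Equiv.tsum_eq e]
  refine tsum_congr fun y => ?_
  simp [e, Equiv.subtypeEquiv_apply, dist_add_right]

/-! ## Isometric images -/

/-- The image `A(F + G) = A F + A G` of a periodic configuration under a linear isometry `A` of
`ℝᵈ` (a rotation or rotoreflection): lattice of periods `A G` (realised as the pull-back of `G`
by `A⁻¹`, Mathlib `ZLattice.comap`, which carries the `DiscreteTopology` and `IsZLattice`
instances), motif `A F`. [folklore] -/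
def isometryImage (A : EuclideanSpace ℝ (Fin d) ≃ₗᵢ[ℝ] EuclideanSpace ℝ (Fin d)) :
    PeriodicConfiguration d where
  lattice := ZLattice.comap ℝ P.lattice A.symm.toContinuousLinearEquiv.toLinearMap
  discrete := inferInstance
  isZLattice := inferInstance
  motif := P.motif.map ⟨A, A.injective⟩
  motif_nonempty := (Finset.map_nonempty).2 P.motif_nonempty
  eq_of_sub_mem := by
    intro x hx y hy hxy
    obtain ⟨x', hx', rfl⟩ := Finset.mem_map.1 hx
    obtain ⟨y', hy', rfl⟩ := Finset.mem_map.1 hy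
    have h : x' - y' ∈ P.lattice := by
      rw [ZLattice.comap, Submodule.mem_comap] at hxy
      simpa using hxy
    simp [P.eq_of_sub_mem x' hx' y' hy' h]

/-- Membership in the lattice of periods of the image: `g ∈ A G ↔ A⁻¹ g ∈ G`. [folklore] -/
theorem mem_lattice_isometryImage (A : EuclideanSpace ℝ (Fin d) ≃ₗᵢ[ℝ] EuclideanSpace ℝ (Fin d))
    {g : EuclideanSpace ℝ (Fin d)} : g ∈ (P.isometryImage A).lattice ↔ A.symm g ∈ P.lattice := by
  show g ∈ ZLattice.comap ℝ P.lattice _ ↔ _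
  rw [ZLattice.comap, Submodule.mem_comap]
  rfl

/-- Points of the image: `z ∈ A(F + G) ↔ A⁻¹ z ∈ F + G`. [folklore] -/
theorem mem_points_isometryImage (A : EuclideanSpace ℝ (Fin d) ≃ₗᵢ[ℝ] EuclideanSpace ℝ (Fin d))
    {z : EuclideanSpace ℝ (Fin d)} : z ∈ (P.isometryImage A).points ↔ A.symm z ∈ P.points := by
  constructor
  · rintro ⟨y, hy, g, hg, rfl⟩
    obtain ⟨y', hy', rfl⟩ := Finset.mem_map.1 hy
    refine ⟨y', hy', A.symm g, (P.mem_lattice_isometryImage A).1 hg, ?_⟩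
    simp
  · rintro ⟨y', hy', g, hg, h⟩
    refine ⟨A y', Finset.mem_map.2 ⟨y', hy', rfl⟩, A g, (P.mem_lattice_isometryImage A).2 (by simpa using hg), ?_⟩
    have : z = A (A.symm z) := (A.apply_symm_apply z).symm
    rw [this, h, map_add]

/-- The motif of the image has the same number of points. [folklore] -/
@[simp] theorem card_motif_isometryImage
    (A : EuclideanSpace ℝ (Fin d) ≃ₗᵢ[ℝ] EuclideanSpace ℝ (Fin d)) :
    (P.isometryImage A).motif.card = P.motif.card := Finset.card_map _

/-- The energy per particle (Blanc–Lewin 2015, (23)) is invariant under linear isometries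
("applying a … rotation or reflexion to the system does not change its energy", §2.1).
[cite: BlancLewin2015, §2.1 (arXiv p. 6)] -/
theorem energyPerParticle_isometryImage (V : ℝ → ℝ)
    (A : EuclideanSpace ℝ (Fin d) ≃ₗᵢ[ℝ] EuclideanSpace ℝ (Fin d)) :
    (P.isometryImage A).energyPerParticle V = P.energyPerParticle V := by
  unfold energyPerParticle
  rw [card_motif_isometryImage]
  congr 1
  rw [show (P.isometryImage A).motif = P.motif.map ⟨A, A.injective⟩ from rfl, Finset.sum_map]
  refine Finset.sum_congr rfl fun x _ => ?_
  simp only [Function.Embedding.coeFn_mk]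
  let e : {y // y ∈ P.points ∧ y ≠ x} ≃ {y // y ∈ (P.isometryImage A).points ∧ y ≠ A x} :=
    A.toEquiv.subtypeEquiv fun y => by
      simp only [ne_eq, mem_points_isometryImage]
      simp
  rw [← Equiv.tsum_eq e]
  refine tsum_congr fun y => ?_
  simp [e, Equiv.subtypeEquiv_apply]

/-! ## Linear and affine images

A homogeneous (affine) deformation `p ↦ A p + t` of a crystal, `A` an invertible linear map, is again a
crystal: the lattice of periods becomes `A G` and the motif `A F + t`.  This is the anchor of every
Cauchy–Born comparison (the energy per particle of the homogeneously deformed crystal is a well-defined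
`energyPerParticle`, hence `≥ ⨅_Q e(Q)`).  Same construction as `isometryImage`, for a continuous linear
equivalence. -/

/-- The image `A(F + G) = A F + A G` of a periodic configuration under an invertible continuous linear map
`A` of `ℝᵈ` (a homogeneous deformation): lattice of periods `A G` (the pull-back `ZLattice.comap` of `G` by
`A⁻¹`, which carries the `DiscreteTopology` and `IsZLattice` instances), motif `A F`. [folklore] -/
def linearImage (A : EuclideanSpace ℝ (Fin d) ≃L[ℝ] EuclideanSpace ℝ (Fin d)) :
    PeriodicConfiguration d where
  lattice := ZLattice.comap ℝ P.lattice A.symm.toLinearMap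
  discrete := inferInstance
  isZLattice := inferInstance
  motif := P.motif.map ⟨A, A.injective⟩
  motif_nonempty := (Finset.map_nonempty).2 P.motif_nonempty
  eq_of_sub_mem := by
    intro x hx y hy hxy
    obtain ⟨x', hx', rfl⟩ := Finset.mem_map.1 hx
    obtain ⟨y', hy', rfl⟩ := Finset.mem_map.1 hy
    have h : x' - y' ∈ P.lattice := by
      rw [ZLattice.comap, Submodule.mem_comap] at hxy
      simpa using hxy
    simp [P.eq_of_sub_mem x' hx' y' hy' h]

/-- Membership in the lattice of periods of the linear image: `g ∈ A G ↔ A⁻¹ g ∈ G`. [folklore] -/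
theorem mem_lattice_linearImage (A : EuclideanSpace ℝ (Fin d) ≃L[ℝ] EuclideanSpace ℝ (Fin d))
    {g : EuclideanSpace ℝ (Fin d)} : g ∈ (P.linearImage A).lattice ↔ A.symm g ∈ P.lattice := by
  show g ∈ ZLattice.comap ℝ P.lattice _ ↔ _
  rw [ZLattice.comap, Submodule.mem_comap]
  rfl

/-- Points of the linear image: `z ∈ A(F + G) ↔ A⁻¹ z ∈ F + G`. [folklore] -/
theorem mem_points_linearImage (A : EuclideanSpace ℝ (Fin d) ≃L[ℝ] EuclideanSpace ℝ (Fin d))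
    {z : EuclideanSpace ℝ (Fin d)} : z ∈ (P.linearImage A).points ↔ A.symm z ∈ P.points := by
  constructor
  · rintro ⟨y, hy, g, hg, rfl⟩
    obtain ⟨y', hy', rfl⟩ := Finset.mem_map.1 hy
    refine ⟨y', hy', A.symm g, (P.mem_lattice_linearImage A).1 hg, ?_⟩
    simp
  · rintro ⟨y', hy', g, hg, h⟩
    refine ⟨A y', Finset.mem_map.2 ⟨y', hy', rfl⟩, A g, (P.mem_lattice_linearImage A).2 (by simpa using hg), ?_⟩
    have : z = A (A.symm z) := (A.apply_symm_apply z).symm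
    rw [this, h, map_add]

/-- The point set of the linear image is the image of the point set: `(A(F+G)) = A '' (F + G)`. [folklore] -/
theorem points_linearImage (A : EuclideanSpace ℝ (Fin d) ≃L[ℝ] EuclideanSpace ℝ (Fin d)) :
    (P.linearImage A).points = A '' P.points := by
  ext z
  rw [mem_points_linearImage, Set.mem_image]
  constructor
  · intro hz
    exact ⟨A.symm z, hz, A.apply_symm_apply z⟩
  · rintro ⟨x, hx, rfl⟩
    simpa using hx

/-- The motif of the linear image has the same number of points. [folklore] -/
@[simp] theorem card_motif_linearImage
    (A : EuclideanSpace ℝ (Fin d) ≃L[ℝ] EuclideanSpace ℝ (Fin d)) :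
    (P.linearImage A).motif.card = P.motif.card := Finset.card_map _

/-- **Affine images of periodic configurations are periodic**: for every invertible continuous linear map
`A` and vector `t` the set `{A p + t : p ∈ F + G}` is the point set of the periodic configuration
`(P.linearImage A).translate t`, with the same number of motif points. [folklore] -/
theorem points_translate_linearImage (A : EuclideanSpace ℝ (Fin d) ≃L[ℝ] EuclideanSpace ℝ (Fin d))
    (t : EuclideanSpace ℝ (Fin d)) :
    ((P.linearImage A).translate t).points = (fun p => A p + t) '' P.points := by
  ext z
  rw [mem_points_translate, mem_points_linearImage, Set.mem_image]
  constructor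
  · intro hz
    exact ⟨A.symm (z - t), hz, by rw [A.apply_symm_apply, sub_add_cancel]⟩
  · rintro ⟨x, hx, rfl⟩
    simpa using hx

end PeriodicConfiguration

end Literature.MathematicalPhysics.StatisticalMechanics

end
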